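import Literature.AnabelianGeometry.AbsoluteAnabelian.NumberFieldValuationProSet
import Literature.NumberTheory.GaloisRepresentations.AbsGaloisInvolutions
import HarnessLib

/-!
# Archimedean decomposition groups are permuted by every automorphism of `G_F`
# (the archimedean clause of the Neukirch gap G-L4d2g4-1, WIRED into the genuine valuation pro-set)

S. Mochizuki, *Topics in absolute anabelian geometry III* [MochizukiAbsTopIII2015], Def 5.1 (i) p. 113 / (iii) p. 115
(`V⊚(F̄/F)` with its `G_F`-action; decomposition groups = stabilisers).  The cell's GENUINE instance is
`NumberField.valuationProSet F` (`NumberFieldValuationProSet.lean`, abc-iut-L4-d2 p432664): archimedean local elements =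
infinite places of `F̄` with Mathlib's action `(σ • w) x = w (σ⁻¹ x)`.

The functoriality of the §5 context along automorphisms `α` of `G_F` (GAP row G-L4d2g4-1) needs, at archimedean places:
**`α` carries the decomposition group of an archimedean place of `F̄` onto the decomposition group of an archimedean
place.**  abc-iut-w5-d214's `AbsGaloisInvolutions.lean` (p435119; Artin–Schreier 1927 Satz 4) PROVES that `α` carries
complex conjugations to complex conjugations (`exists_isComplexConjugationAt_map_of_mulEquiv`).  THIS PROOF-ONLY FILE
(0 definitions; abc-iut-L4-d2, row «G-L4d2g4-1-ARCH-WIRING») wires that theorem into the pro-set's vocabulary: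

* `isComplexConjugationAt_of_isConj` — bridge from Mathlib's stabiliser vocabulary (`ComplexEmbedding.IsConj ι c`: `c`
  induces complex conjugation on the embedding `ι : F̄ → ℂ`) to the tree's `IsComplexConjugationAt` at the (real) place
  of `F` under `ι`;
* **`exists_stabilizer_infinitePlace_map_eq`** — for every group automorphism `α` of `Gal(F̄/F)` and every infinite
  place `w` of `F̄` there is an infinite place `w'` with `α(Stab w) = Stab w'` (over a real place `Stab w = {1, c_w}`,
  Mathlib `IsConj.coe_stabilizer_mk`, and `α c_w` is the conjugation of some `ι'` by p435119 — take `w' = [ι']`; over a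
  complex place `Stab w = 1`);
* **`exists_decomp_arc_map_eq`** — the same for the decomposition groups `(NumberField.valuationProSet F).decomp` of
  archimedean local elements and a continuous automorphism `α : G_F ≃ₜ* G_F` (the N1-shape archimedean clause of
  G-L4d2g4-1 in the GENUINE pro-set's vocabulary).

The NON-archimedean clause (Neukirch's local correspondence / Neukirch–Uchida) remains the open GAP (campaign-L);
nothing here bears on [IUTchIII] Cor. 3.12 or takes a side.
-/

noncomputable section

open scoped Pointwise
open NumberField NumberField.InfinitePlace NumberField.ComplexEmbedding
open Literature.NumberTheory.GaloisRepresentations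

namespace Literature.AnabelianGeometry.AbsoluteAnabelian.NumberFieldValuationProSet

open Field

variable (F : Type) [Field F]

/-! ### Bridge: `IsConj` on an embedding of `F̄` ⇒ complex conjugation at the real place of `F` below -/

/-- If `c ∈ G_F` induces complex conjugation on an embedding `ι : F̄ → ℂ` (Mathlib `ComplexEmbedding.IsConj ι c`), then
`c` is a complex conjugation AT the real place of `F` under `ι` (the tree's `IsComplexConjugationAt`).
[cite: MochizukiAbsTopIII2015, Def 5.1 (i) p.113] -/
theorem isComplexConjugationAt_of_isConj {ι : AlgebraicClosure F →+* ℂ}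
    {c : AlgebraicClosure F ≃ₐ[F] AlgebraicClosure F} (h : ComplexEmbedding.IsConj ι c) :
    ∃ (v : InfinitePlace F) (hv : v.IsReal), IsComplexConjugationAt hv (c : absoluteGaloisGroup F) := by
  have hreal : ComplexEmbedding.IsReal (ι.comp (algebraMap F (AlgebraicClosure F))) := h.isReal_comp
  refine ⟨InfinitePlace.mk (ι.comp (algebraMap F (AlgebraicClosure F))), ⟨_, hreal, rfl⟩, ?_⟩
  rw [isComplexConjugationAt_iff]
  refine ⟨ι, ?_, h⟩
  rw [ComplexEmbedding.liesOver_iff, InfinitePlace.embedding_mk_eq_of_isReal hreal]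

/-- Conversely, a complex conjugation at a real place of `F` induces complex conjugation on some embedding of `F̄`.
[cite: MochizukiAbsTopIII2015, Def 5.1 (i) p.113] -/
theorem exists_isConj_of_isComplexConjugationAt {v : InfinitePlace F} (hv : v.IsReal)
    {c : absoluteGaloisGroup F} (hc : IsComplexConjugationAt hv c) :
    ∃ ι : AlgebraicClosure F →+* ℂ,
      ComplexEmbedding.IsConj ι (absoluteGaloisGroup.toAlgEquiv F c) := by
  rw [isComplexConjugationAt_iff] at hc
  obtain ⟨ι, _, hι⟩ := hc
  exact ⟨ι, hι⟩

/-! ### Stabilisers of infinite places of `F̄` -/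

/-- The stabiliser of an infinite place of `F̄` is trivial unless some non-trivial element induces complex conjugation on
its embedding. [cite: MochizukiAbsTopIII2015, Def 5.1 (iii) p.115] -/
theorem stabilizer_infinitePlace_eq_bot {w : InfinitePlace (AlgebraicClosure F)}
    (h : ∀ σ : AlgebraicClosure F ≃ₐ[F] AlgebraicClosure F, ComplexEmbedding.IsConj w.embedding σ → σ = 1) :
    MulAction.stabilizer (AlgebraicClosure F ≃ₐ[F] AlgebraicClosure F) w = ⊥ := by
  rw [eq_bot_iff]
  intro σ hσ
  rw [← InfinitePlace.mk_embedding w, InfinitePlace.mem_stabilizer_mk_iff] at hσ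
  rw [Subgroup.mem_bot]
  rcases hσ with hσ | hσ
  · exact hσ
  · exact h σ hσ

/-- **Every group automorphism `α` of `Gal(F̄/F)` carries the stabiliser (decomposition group) of an infinite place of `F̄`
onto the stabiliser of an infinite place of `F̄`** — `{1, c_w} ↦ {1, α c_w}` over a real place (Artin–Schreier via
abc-iut-w5-d214's `exists_isComplexConjugationAt_map_of_mulEquiv`), `1 ↦ 1` over a complex place.
[cite: ArtinSchreier1927Kennzeichnung, Satz 4 (direct corollary)] -/
theorem exists_stabilizer_infinitePlace_map_eq [NumberField F]
    (α : (AlgebraicClosure F ≃ₐ[F] AlgebraicClosure F) ≃* (AlgebraicClosure F ≃ₐ[F] AlgebraicClosure F))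
    (w : InfinitePlace (AlgebraicClosure F)) :
    ∃ w' : InfinitePlace (AlgebraicClosure F),
      (MulAction.stabilizer (AlgebraicClosure F ≃ₐ[F] AlgebraicClosure F) w).map α.toMonoidHom =
        MulAction.stabilizer (AlgebraicClosure F ≃ₐ[F] AlgebraicClosure F) w' := by
  by_cases hex : ∃ c : AlgebraicClosure F ≃ₐ[F] AlgebraicClosure F, c ≠ 1 ∧ ComplexEmbedding.IsConj w.embedding c
  · obtain ⟨c, _, hc⟩ := hex
    -- `c` is a complex conjugation at the real place of `F` below `w`; so is `α c` at some real place
    obtain ⟨v, hv, hcv⟩ := isComplexConjugationAt_of_isConj F hc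
    obtain ⟨v', hv', hcv'⟩ :=
      exists_isComplexConjugationAt_map_of_mulEquiv (K := F) (α : absoluteGaloisGroup F ≃* absoluteGaloisGroup F)
        hv hcv
    obtain ⟨ι', hι'⟩ := exists_isConj_of_isComplexConjugationAt F hv' hcv'
    refine ⟨InfinitePlace.mk ι', ?_⟩
    apply SetLike.coe_injective
    have h1 : ((MulAction.stabilizer (AlgebraicClosure F ≃ₐ[F] AlgebraicClosure F) w :
        Subgroup (AlgebraicClosure F ≃ₐ[F] AlgebraicClosure F)) : Set _) = {1, c} := by
      rw [← InfinitePlace.mk_embedding w]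
      exact hc.coe_stabilizer_mk
    have h2 : ((MulAction.stabilizer (AlgebraicClosure F ≃ₐ[F] AlgebraicClosure F) (InfinitePlace.mk ι') :
        Subgroup (AlgebraicClosure F ≃ₐ[F] AlgebraicClosure F)) : Set _) = {1, α c} :=
      hι'.coe_stabilizer_mk
    rw [Subgroup.coe_map, h1, h2, Set.image_insert_eq, Set.image_singleton]
    simp
  · -- trivial stabiliser
    have hbot : MulAction.stabilizer (AlgebraicClosure F ≃ₐ[F] AlgebraicClosure F) w = ⊥ :=
      stabilizer_infinitePlace_eq_bot F fun σ hσ => by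
        by_contra hne
        exact hex ⟨σ, hne, hσ⟩
    refine ⟨w, ?_⟩
    rw [hbot, Subgroup.map_bot]

/-! ### In the vocabulary of the genuine valuation pro-set -/

/-- The decomposition group of an archimedean local element of `V⊚(F̄/F)` is the Mathlib stabiliser of the infinite place.
[cite: MochizukiAbsTopIII2015, Def 5.1 (iii) p.115] -/
theorem decomp_inr_inr_eq_stabilizer (w : Arch F) :
    (NumberField.valuationProSet F).decomp (Sum.inr (Sum.inr w)) =
      ((MulAction.stabilizer (AlgebraicClosure F ≃ₐ[F] AlgebraicClosure F) w :
        Subgroup (AlgebraicClosure F ≃ₐ[F] AlgebraicClosure F)) : Subgroup (absoluteGaloisGroup F)) := by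
  ext σ
  rw [mem_decomp_inr_inr_iff]
  exact Iff.rfl

/-- **Archimedean clause of G-L4d2g4-1 at the GENUINE pro-set**: every continuous automorphism `α` of `G_F` carries the
decomposition group of an archimedean local element of `V⊚(F̄/F)` onto the decomposition group of an archimedean local
element. [cite: ArtinSchreier1927Kennzeichnung, Satz 4 (direct corollary)] -/
theorem exists_decomp_arc_map_eq [NumberField F] (α : absoluteGaloisGroup F ≃ₜ* absoluteGaloisGroup F) (w : Arch F) :
    ∃ w' : Arch F,
      ((NumberField.valuationProSet F).decomp (Sum.inr (Sum.inr w))).map α.toMulEquiv.toMonoidHom =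
        (NumberField.valuationProSet F).decomp (Sum.inr (Sum.inr w')) := by
  obtain ⟨w', hw'⟩ := exists_stabilizer_infinitePlace_map_eq F
    (α.toMulEquiv : (AlgebraicClosure F ≃ₐ[F] AlgebraicClosure F) ≃* (AlgebraicClosure F ≃ₐ[F] AlgebraicClosure F)) w
  refine ⟨w', ?_⟩
  rw [decomp_inr_inr_eq_stabilizer, decomp_inr_inr_eq_stabilizer]
  exact hw'

end Literature.AnabelianGeometry.AbsoluteAnabelian.NumberFieldValuationProSet

end
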